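import Literature.Geometry.Lorentzian.CarterConeInteriorRate
import Literature.Geometry.Lorentzian.CarterCapEnvelopeSharp
import Literature.Geometry.Lorentzian.CarterFluxKernelBound
import Literature.Analysis.ODE.DeepBarrierKernelBound
import HarnessLib

/-!
# The superradiant Breitenlohner–Freedman-stable Green-kernel bound for Carter's equation, with its
# explicit constant (tortoise variable)
(namespace `Literature.Geometry.Lorentzian.Kerr`.)

Carter's radial equation `u″ + φu = 0`, `φ = ω² − V∘ρ` (`V = Kerr.sepPotential M a ω m Λ`, `ρ` a tortoise
radius; DRSR arXiv:1402.7034 §5.2.3) at an admissible `(ω, m, Λ)`, `Λ ≥ 1`, in the SUPERRADIANT regime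
`ωσ < 0` (`σ := ω − mω₊`, `|σ| ≤ |ω|`), in a BF-stable sector with margin `(1 + θ₁)(2r₊ω)² ≤ Λ′ := Λ − 2amω`,
`0 < θ₁ ≤ 1`, with `σ` small against `Λ′` (`18432 M²σ² ≤ θ₁⁴Λ′`, `σ²M² ≤ Λ`) and `89600 ≤ θ₁³Λ′`, and
GIVEN the census (`{r > r₊ : ω² ≤ V r}` order-connected). For the horizon-data solution `u_𝓗`
(`‖u_𝓗‖ → 1`, `‖u_𝓗′‖ → |σ|`, flux `−σ`) and the infinity-data solution `u_𝓘` (`‖u_𝓘‖ → 1`, `‖u_𝓘′‖ → |ω|`,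
flux `ω`):

* `superradiant_kernel_le` — for ALL `x ≤ x′`,
  `‖u_𝓗 x‖·‖u_𝓘 x′‖ ≤ K(P_u, P_v, P₁, Q₁, σ, ω, R_α, R_β, R_m)·‖u_𝓗 u_𝓘′ − u_𝓘 u_𝓗′‖(x)` with the constant `K`
  of `Literature.Analysis.ODE.kernel_le_of_deep_barrier` at the explicit envelopes and rates
  `P_u = 2 + √2|σ|L`, `P₁ = √2|σ|` (sharp cap bounds, `Kerr.carter_cap_norm_le`; `L = (25/κ)log(2496Λ/(σ²M²))`),
  `P_v² = (2 + 2|ω|R)² + B/η²`, `Q₁² = 2ω² + B` (`Kerr.carter_envelope_I(_deriv)_of_far_start` with the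
  κ-free far start `ζ = θ₁M/4` of `Kerr.le_rho_of_forbidden_eq_Icc`, `η = θ₁/(100M)`,
  `R = max(7M, √(12Λ)/|ω|, 1/(Mω²))`), `R_α = L + 2/k`, `R_β = 200M/θ₁ + (7/5)R + 2/k`,
  `R_m = L + 200M/θ₁ + (7/5)R + 4/k` (`Kerr.carter_cone_depth_and_rates`, `k = √(θ₁³Λ′/(3584r₊²))`),
  PROVIDED the κ-FREE numerical depth `64(2ω² + B) ≤ k²·exp(4r₊k/5)` (the exponential depth
  `(k/4)e^{2r₊k/5} ≤ w₀` of the barrier basis then gives `2P₁²Q₁² ≤ |σ||ω|w₀²`).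

Pure assembly (`Kerr.forbidden_interval`, `Kerr.exists_coeff_nonpos_far_collar`,
`Kerr.rho_ends_of_forbidden_eq_Icc`); no sign condition on the Wronskian pairing is used. NOT here: the cone
bookkeeping turning `K` into `CΛ^Nκ^{−N}` and the depth from `Λ` large.

## References
* M. Dafermos, I. Rodnianski, Y. Shlapentokh-Rothman, arXiv:1402.7034 = Ann. of Math. 183 (2016),
  §§5.2.3, 6.3, 8 (key `DafermosRodnianskiShlapentokhrothman2014`).
* P. Hartman, *Ordinary Differential Equations* (SIAM Classics 38, 2002), Ch. XI §§2, 6 (key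
  `Hartman2002`). The assembly is folklore.
-/

noncomputable section

open Filter Set Literature.Analysis.ODE
open scoped _root_.Topology _root_.ComplexConjugate

namespace Literature.Geometry.Lorentzian

namespace Kerr

section SuperradiantRegime

variable {M a ω Λ : ℝ} {m : ℤ} {ρ : ℝ → ℝ} {uH uH₁ uI uI₁ : ℝ → ℂ}

/-- `(e^y)² = e^{2y}` in the form `(k/4·e^{2rk/5})² = k²/16 · e^{4rk/5}`. [folklore] -/
private theorem depth_sq_eq (k r : ℝ) :
    (k / 4 * Real.exp (2 * r * k / 5)) ^ 2 = k ^ 2 / 16 * Real.exp (4 * r * k / 5) := by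
  rw [mul_pow, sq (Real.exp _), ← Real.exp_add]
  ring_nf

set_option maxHeartbeats 400000 in
-- long statement with the explicit constant; the proof is plumbing
/-- **The superradiant BF-stable kernel bound for Carter's equation with its explicit constant.** See the
module docstring: census + sharp cap envelope + κ-free far envelope + depth-and-rates of the barrier basis,
merged by `kernel_le_of_deep_barrier`; valid for all `x ≤ x′` once `64(2ω² + B) ≤ k²e^{4r₊k/5}`. [folklore] -/
theorem superradiant_kernel_le (hρ : IsTortoiseRadius M a ρ) (hMa : IsSubextremal M a)
    (hadm : IsAdmissibleTriple a ω m Λ) (hΛ : 1 ≤ Λ)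
    (hσ : ω - m * horizonAngularVelocity M a ≠ 0) (hω : ω ≠ 0)
    {θ₁ : ℝ} (hθ₁ : 0 < θ₁) (hθ₁1 : θ₁ ≤ 1)
    (hmargin : (1 + θ₁) * (2 * rPlus M a * ω) ^ 2 ≤ Λ - 2 * a * m * ω)
    (hωσ : ω * (ω - m * horizonAngularVelocity M a) < 0)
    (hσω : |ω - m * horizonAngularVelocity M a| ≤ |ω|)
    (hσsmall : 18432 * M ^ 2 * (ω - m * horizonAngularVelocity M a) ^ 2 ≤ θ₁ ^ 4 * (Λ - 2 * a * m * ω))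
    (hΛ' : 89600 ≤ θ₁ ^ 3 * (Λ - 2 * a * m * ω))
    (hσΛ : (ω - m * horizonAngularVelocity M a) ^ 2 * M ^ 2 ≤ Λ)
    (hord : (Ioi (rPlus M a) ∩ {r : ℝ | ω ^ 2 ≤ sepPotential M a ω m Λ r}).OrdConnected)
    (hu : ∀ x, HasDerivAt uH (uH₁ x) x ∧
      HasDerivAt uH₁ (-(((ω ^ 2 - sepPotential M a ω m Λ (ρ x) : ℝ) : ℂ) * uH x)) x)
    (hv : ∀ x, HasDerivAt uI (uI₁ x) x ∧
      HasDerivAt uI₁ (-(((ω ^ 2 - sepPotential M a ω m Λ (ρ x) : ℝ) : ℂ) * uI x)) x)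
    (hH0 : Tendsto (fun x ↦ ‖uH x‖) atBot (𝓝 1))
    (hH1 : Tendsto (fun x ↦ ‖uH₁ x‖) atBot (𝓝 |ω - m * horizonAngularVelocity M a|))
    (hHf : ∀ x, (starRingEnd ℂ (uH x) * uH₁ x).im = -(ω - m * horizonAngularVelocity M a))
    (hI0 : Tendsto (fun x ↦ ‖uI x‖) atTop (𝓝 1))
    (hI1 : Tendsto (fun x ↦ ‖uI₁ x‖) atTop (𝓝 |ω|))
    (hIf : ∀ x, (starRingEnd ℂ (uI x) * uI₁ x).im = ω)
    {σ L k R B Pu Pv P₁ Q₁ Rα Rβ Rm : ℝ} (hσdef : σ = ω - m * horizonAngularVelocity M a)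
    (hLdef : L = 25 / surfaceGravity M a * Real.log (2496 * Λ / (σ ^ 2 * M ^ 2)))
    (hkdef : k = Real.sqrt (θ₁ ^ 3 * (Λ - 2 * a * m * ω) / (3584 * rPlus M a ^ 2)))
    (hRdef : R = max (7 * M) (max (Real.sqrt (12 * Λ) / |ω|) (1 / (M * ω ^ 2))))
    (hBdef : B = ((ω ^ 2 + 6 * Λ / M ^ 2) / (θ₁ / (100 * M)) ^ 2) ^ 16 *
      Real.exp (2 * (θ₁ / (100 * M)) * (50 * M ^ 2 / (θ₁ * M / 4))) *
      ((θ₁ / (100 * M)) ^ 2 * (2 + 2 * |ω| * R) ^ 2 + 2 * ω ^ 2))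
    (hPudef : Pu = 2 + Real.sqrt 2 * |σ| * L)
    (hPvdef : Pv = Real.sqrt ((2 + 2 * |ω| * R) ^ 2 + B / (θ₁ / (100 * M)) ^ 2))
    (hP₁def : P₁ = Real.sqrt 2 * |σ|) (hQ₁def : Q₁ = Real.sqrt (2 * ω ^ 2 + B))
    (hRαdef : Rα = L + 2 / k) (hRβdef : Rβ = 200 * M / θ₁ + 7 / 5 * R + 2 / k)
    (hRmdef : Rm = L + 200 * M / θ₁ + 7 / 5 * R + 4 / k)
    (hdeep : 64 * (2 * ω ^ 2 + B) ≤ k ^ 2 * Real.exp (4 * rPlus M a * k / 5))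
    {x x' : ℝ} (hxx' : x ≤ x') :
    ‖uH x‖ * ‖uI x'‖ ≤
      (3 * Pu ^ 2 / |σ| + 3 * Pv ^ 2 / |ω| + 2 * Pu * Pv / Real.sqrt (|ω| * |σ|) +
        Pu * (2 * Q₁ * Rβ / Real.sqrt (|ω| * |σ|) + 2 * P₁ * Rα / |σ|) +
        Pv * (2 * Q₁ * Rβ / |ω| + 2 * P₁ * Rα / Real.sqrt (|ω| * |σ|)) +
        (2 * Q₁ ^ 2 * Rβ ^ 2 / |ω| + 2 * Rm + 2 * P₁ * Q₁ * (Rα * Rβ) / Real.sqrt (|ω| * |σ|) +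
          2 * P₁ ^ 2 * Rα ^ 2 / |σ|)) * ‖uH x * uI₁ x - uI x * uH₁ x‖ := by
  subst hσdef hLdef hRdef hkdef hRαdef hRβdef hRmdef
  have hM : 0 < M := hMa.pos
  have ha : |a| < M := hMa
  have haM : |a| ≤ M := le_of_lt hMa
  set σ := ω - (m : ℝ) * horizonAngularVelocity M a with hσ'
  set Λ' := Λ - 2 * a * m * ω with hΛ'def
  set rp := rPlus M a with hrp
  set k := Real.sqrt (θ₁ ^ 3 * Λ' / (3584 * rp ^ 2)) with hk
  set R := max (7 * M) (max (Real.sqrt (12 * Λ) / |ω|) (1 / (M * ω ^ 2))) with hR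
  set L := 25 / surfaceGravity M a * Real.log (2496 * Λ / (σ ^ 2 * M ^ 2)) with hL
  set η := θ₁ / (100 * M) with hη
  set φ : ℝ → ℝ := fun s ↦ ω ^ 2 - sepPotential M a ω m Λ (ρ s) with hφ
  have hcont : Continuous φ := continuous_iff_continuousAt.2 fun s ↦
    (hρ.hasDerivAt_omega_sq_sub_sepPotential hMa ω m Λ s).continuousAt
  -- scalar facts
  have hrp0 : 0 < rp := rPlus_pos hM a
  have hκ : 0 < surfaceGravity M a := hMa.surfaceGravity_pos
  have hσabs : 0 < |σ| := abs_pos.2 hσ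
  have hωabs : 0 < |ω| := abs_pos.2 hω
  have hω2 : 0 < ω ^ 2 := by positivity
  have hΛ'0 : 0 < Λ' := by
    by_contra hle
    push Not at hle
    have : θ₁ ^ 3 * Λ' ≤ 0 := mul_nonpos_of_nonneg_of_nonpos (by positivity) hle
    linarith
  have hΛ'100 : 100 ≤ Λ' := by
    have h1 : θ₁ ^ 3 * Λ' ≤ 1 * Λ' :=
      mul_le_mul_of_nonneg_right (pow_le_one₀ hθ₁.le hθ₁1) hΛ'0.le
    linarith
  have hσ2304 : 2304 * M ^ 2 * σ ^ 2 ≤ θ₁ ^ 4 * Λ' := by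
    have : 0 ≤ M ^ 2 * σ ^ 2 := by positivity
    linarith
  have hk2 : k ^ 2 = θ₁ ^ 3 * Λ' / (3584 * rp ^ 2) := Real.sq_sqrt (by positivity)
  have hk0 : 0 < k := Real.sqrt_pos.2 (by positivity)
  have hR7 : 7 * M ≤ R := le_max_left _ _
  have hR0 : 0 ≤ R := le_trans (by positivity) hR7
  have hη0 : 0 < η := by rw [hη]; positivity
  have hL0 : 0 ≤ L := by
    have hQ : 1 ≤ 2496 * Λ / (σ ^ 2 * M ^ 2) := by
      rw [le_div_iff₀ (by positivity), one_mul]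
      calc σ ^ 2 * M ^ 2 ≤ Λ := hσΛ
        _ ≤ 2496 * Λ := by linarith
    exact mul_nonneg (div_nonneg (by norm_num) hκ.le) (Real.log_nonneg hQ)
  -- the horizon-zone edge `xa` and the point `x₇`
  have hxap : rp < rp + σ ^ 2 * M ^ 3 / (416 * Λ) := lt_add_of_pos_right _ (by positivity)
  obtain ⟨xa, hxa⟩ := hρ.exists_apply_eq hxap
  have h7p : rp < 7 * M := by linarith [rPlus_le_two_mul_self hM.le a]
  obtain ⟨x₇, hx₇⟩ := hρ.exists_apply_eq h7p
  -- the barrier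
  rcases forbidden_interval hρ hMa hadm hΛ hσ hω hord hxa with
    hposall | ⟨b₁, b₂, hxab, hb, -, hb₂R, hF, hφ₁, hφ₂⟩
  · exfalso
    obtain ⟨s, hs, -⟩ := exists_coeff_nonpos_far_collar hρ hMa hθ₁ hθ₁1 hmargin hσ2304
    exact absurd (hposall s) (not_lt.2 hs)
  rw [← hR] at hb₂R
  have hout : ∀ s, s ∉ Icc b₁ b₂ → 0 < φ s := by
    intro s hs
    by_contra h
    push Not at h
    have : s ∈ {s | φ s ≤ 0} := h
    rw [hF] at this
    exact hs this
  have hposH : ∀ s, s ≤ b₁ → 0 ≤ ω ^ 2 - sepPotential M a ω m Λ (ρ s) := by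
    intro s hs
    rcases hs.eq_or_lt with h | h
    · rw [h]; exact le_of_eq hφ₁.symm
    · exact (hout s fun hm ↦ absurd hm.1 (not_le.2 h)).le
  have hposI : ∀ s, b₂ ≤ s → 0 ≤ ω ^ 2 - sepPotential M a ω m Λ (ρ s) := by
    intro s hs
    rcases hs.eq_or_lt with h | h
    · rw [← h]; exact le_of_eq hφ₂.symm
    · exact (hout s fun hm ↦ absurd hm.2 (not_le.2 h)).le
  have hφneg : ∀ s ∈ Icc b₁ b₂, φ s ≤ 0 := by
    intro s hs
    have : s ∈ {s | φ s ≤ 0} := by rw [hF]; exact hs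
    exact this
  -- the turning points relative to the good zone, and the far start `ζ = θ₁M/4`
  obtain ⟨hb₁zone, -⟩ := rho_ends_of_forbidden_eq_Icc hρ hMa hθ₁ hθ₁1 hmargin hσsmall hF
  have hZ : rp + θ₁ * M / 4 ≤ ρ b₂ := le_rho_of_forbidden_eq_Icc hρ hMa hθ₁ hθ₁1 hmargin hσ2304 hF
  have hζ : 0 < θ₁ * M / 4 := by positivity
  -- the cap envelopes (sharp)
  have hcap : ∀ s, s ≤ b₁ → ‖uH s‖ ≤ Pu ∧ ‖uH₁ s‖ ≤ P₁ := by
    intro s hs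
    have h := carter_cap_norm_le hρ hMa hadm hΛ hσΛ hθ₁ hθ₁1 hmargin hωσ hΛ'100 hu hH0 hH1 hposH hb₁zone hs
    rw [← hL] at h
    rw [hPudef, hP₁def]
    exact h
  have hPu : ∀ s, s ≤ b₁ → ‖uH s‖ ≤ Pu := fun s hs ↦ (hcap s hs).1
  have hP₁ : ‖uH₁ b₁‖ ≤ P₁ := (hcap b₁ le_rfl).2
  -- the far envelopes
  have hΦη : η ^ 2 ≤ ω ^ 2 + 6 * Λ / M ^ 2 := by
    rw [hη]
    have h1 : (θ₁ / (100 * M)) ^ 2 ≤ 6 * Λ / M ^ 2 := by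
      rw [div_pow, div_le_div_iff₀ (by positivity) (by positivity)]
      have hθ2 : θ₁ ^ 2 ≤ 1 := pow_le_one₀ hθ₁.le hθ₁1
      have hM2 : 0 ≤ M ^ 2 := sq_nonneg M
      have h2 : θ₁ ^ 2 * M ^ 2 ≤ 1 * M ^ 2 := mul_le_mul_of_nonneg_right hθ2 hM2
      have h3 : 1 * M ^ 2 ≤ 6 * Λ * (100 * M) ^ 2 := by
        have e : 6 * Λ * (100 * M) ^ 2 = 60000 * Λ * M ^ 2 := by ring
        rw [e]; nlinarith only [hΛ, hM2]
      exact h2.trans h3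
    linarith only [h1, hω2]
  have hΦall : ∀ s, ω ^ 2 - sepPotential M a ω m Λ (ρ s) ≤ ω ^ 2 + 6 * Λ / M ^ 2 := fun s ↦
    coeff_le_of_admissible hM haM hadm hΛ (hρ.rPlus_lt s).le
  have hB0 : 0 ≤ B := by rw [hBdef]; positivity
  have hPv : ∀ s, b₂ ≤ s → ‖uI s‖ ≤ Pv := by
    intro s hs
    have h := carter_envelope_I_of_far_start hρ hMa hadm hω hv hI0 hI1 hx₇ hζ hZ hη0 hΦη hΦall hposI hs
    rw [← hR, ← hBdef] at h
    rw [hPvdef]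
    exact Real.le_sqrt_of_sq_le h
  have hQ₁ : ‖uI₁ b₂‖ ≤ Q₁ := by
    have h := carter_envelope_I_deriv_of_far_start hρ hMa hadm hω hv hI0 hI1 hx₇ hζ hZ hη0 hΦη hΦall
      hposI le_rfl
    rw [← hR, ← hBdef] at h
    rw [hQ₁def]
    exact Real.le_sqrt_of_sq_le h
  have hP₁sq : P₁ ^ 2 = 2 * σ ^ 2 := by
    rw [hP₁def, mul_pow, Real.sq_sqrt (by norm_num : (0:ℝ) ≤ 2), sq_abs]
  have hQ₁sq : Q₁ ^ 2 = 2 * ω ^ 2 + B := by rw [hQ₁def, Real.sq_sqrt (by positivity)]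
  -- non-negativity of the rates
  have hRα0 : 0 ≤ L + 2 / k := by positivity
  have hRβ0 : 0 ≤ 200 * M / θ₁ + 7 / 5 * R + 2 / k := by positivity
  have hRm0 : 0 ≤ L + 200 * M / θ₁ + 7 / 5 * R + 4 / k := by positivity
  -- the basis hypothesis
  have hbasis : ∀ g g' d d' : ℝ → ℝ, ∀ w₀ : ℝ,
      (∀ x ∈ Icc b₁ b₂, HasDerivAt g (g' x) x ∧ HasDerivAt g' (-φ x * g x) x) →
      (∀ x ∈ Icc b₁ b₂, HasDerivAt d (d' x) x ∧ HasDerivAt d' (-φ x * d x) x) →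
      g b₁ = 1 → g' b₁ = 0 → d b₂ = 1 → d' b₂ = 0 → g' b₂ = w₀ →
      (∀ x ∈ Icc b₁ b₂, 1 ≤ g x ∧ 0 ≤ g' x ∧ 1 ≤ d x ∧ d' x ≤ 0) →
      MonotoneOn g (Icc b₁ b₂) → AntitoneOn d (Icc b₁ b₂) →
      (∀ x ∈ Icc b₁ b₂, g x * d' x - g' x * d x = -w₀) →
        2 * P₁ ^ 2 * Q₁ ^ 2 ≤ |σ| * |ω| * w₀ ^ 2 ∧ d b₁ ≤ (L + 2 / k) * w₀ ∧
          g b₂ ≤ (200 * M / θ₁ + 7 / 5 * R + 2 / k) * w₀ ∧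
          ∀ x ∈ Icc b₁ b₂, x' ≤ x → g x * d x ≤ (L + 200 * M / θ₁ + 7 / 5 * R + 4 / k) * w₀ := by
    intro g g' d d' w₀ hg hd hgα hg'α _ _ hg'β hsign _ _ hW
    obtain ⟨hDw, h2, h3, h4⟩ := carter_cone_depth_and_rates hρ hMa hΛ hσ hθ₁ hθ₁1 hmargin hσsmall hΛ' hF
      hxa hxab.le hR7 hb₂R.le hg hd hgα hg'α hg'β hsign hW
    rw [← hk] at hDw h2 h3 h4
    rw [← hL] at h2 h4
    refine ⟨?_, h2, h3, fun x hx _ ↦ h4 x hx⟩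
    -- depth: `2P₁²Q₁² = 4σ²(2ω² + B) ≤ 4|σ||ω|(2ω² + B) ≤ |σ||ω|D² ≤ |σ||ω|w₀²`
    have hD0 : 0 ≤ k / 4 * Real.exp (2 * rp * k / 5) := by positivity
    have hw2 : (k / 4 * Real.exp (2 * rp * k / 5)) ^ 2 ≤ w₀ ^ 2 := pow_le_pow_left₀ hD0 hDw 2
    rw [depth_sq_eq] at hw2
    have hσle : σ ^ 2 ≤ |σ| * |ω| := by
      rw [← sq_abs, sq]; exact mul_le_mul_of_nonneg_left hσω (abs_nonneg _)
    have hE0 : 0 ≤ 2 * ω ^ 2 + B := by positivity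
    calc 2 * P₁ ^ 2 * Q₁ ^ 2 = 4 * σ ^ 2 * (2 * ω ^ 2 + B) := by rw [hP₁sq, hQ₁sq]; ring
      _ ≤ 4 * (|σ| * |ω|) * (2 * ω ^ 2 + B) := by gcongr
      _ = |σ| * |ω| * (64 * (2 * ω ^ 2 + B)) / 16 := by ring
      _ ≤ |σ| * |ω| * (k ^ 2 * Real.exp (4 * rp * k / 5)) / 16 := by gcongr
      _ = |σ| * |ω| * (k ^ 2 / 16 * Real.exp (4 * rp * k / 5)) := by ring
      _ ≤ |σ| * |ω| * w₀ ^ 2 := by gcongr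
  exact kernel_le_of_deep_barrier (φ := φ) hu hv hHf hIf hσ hω hb hcont hφneg hPu hPv hP₁ hQ₁ hRα0 hRβ0
    hRm0 hbasis hxx' le_rfl

end SuperradiantRegime

end Kerr

end Literature.Geometry.Lorentzian

end
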